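import Mathlib
import Summits.NavierStokesRegularity.NavierStokesRegularity.Theses.CloudStretchingBudget
import Summits.NavierStokesRegularity.NavierStokesRegularity.Theorems.TypeICertificateLadderTypeIConcentration
import Summits.NavierStokesRegularity.NavierStokesRegularity.Theorems.TypeICertificateLadderLadderGlue
import Summits.NavierStokesRegularity.NavierStokesRegularity.Theorems.TypeICertificateLadderNoBlowupToClay
import Summits.NavierStokesRegularity.NavierStokesRegularity.Theorems.AdaptedFrequencyAdaptedKernelExists
import HarnessLib

/-!
# Route CloudStretchingBudget — the frame supports `CloudKillsTypeIRungs`, `TypeIRungsToClay` and the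
  `Assembly` PROVED (stmt-NavierStokesRegularity-18464 / 18465 / 18525)

The by-name recombination announced in the route file (rev 1, cone repair 2026-08-17), made
literal in a Theorems module that imports the route file (so that the route file itself stays in
the Clay-statement cone):

* `cloudStretchingBudget_cloudKillsTypeIRungs_proof`: the four joint items kill every rung `X_C` of
  the Type-I ladder — at a rung-`C` solution that does not extend, pick the concentration point
  `x₀` by the PROVED `typeIConcentration_proof` (a = `TypeICertificateLadder.TypeIConcentration`,
  stmt-2881) and the adapted kernel `(t₀, G)` by the PROVED
  `adaptedFrequency_adaptedKernelExists_proof` (b = `AdaptedFrequency.AdaptedKernelExists`,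
  stmt-2956; the rung rate is a Type-I rate); `AdaptedVorticityFloor` puts `m ≤ (T − t)M(t)`
  eventually, `CloudKatoBudget` + `SubunitCloudStretching` feed `GronwallClock` (quantities
  instantiated by `rfl`), so `(T − t)M(t) < m` eventually: contradiction.
* `cloudStretchingBudget_typeIRungsToClay_proof`: all rungs + `NoTypeII` give Clay (A) via the PROVED
  `typeICertificateLadder_noBlowupToClay_proof` (stmt-0055) and
  `typeICertificateLadder_ladderGlue_proof` (stmt-2887).
* `cloudStretchingBudget_assembly_proof`: the curried deciding theorem (pure logic, = `closes`).

HONEST FRAMING: pure logic over the route's items and two proved cruxes of other routes; the route's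
bet (`SubunitCloudStretching`), `AdaptedVorticityFloor`, `CloudKatoBudget` and `NoTypeII` remain
OPEN hypotheses; nothing here bears on the regularity question itself. Lands
`--workitem stmt-NavierStokesRegularity-18464` (typer seat g19 of cell pub-ns-dss, idle-row item;
the planner's evidence `FrameProofs.lean` is not readable from this seat, so the proofs are re-derived
from the route file's docstrings).
-/

noncomputable section

set_option linter.dupNamespace false

namespace Summit.NavierStokesRegularity.NavierStokesRegularity.Theorems

open MeasureTheory Set Filter Topology
open scoped Topology
open Literature.Analysis.FluidPDE

/-- **`CloudKillsTypeIRungs` (stmt-NavierStokesRegularity-18464).** The four joint items of the route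
(`AdaptedVorticityFloor`, `CloudKatoBudget`, `GronwallClock`, `SubunitCloudStretching`) imply every
rung `X_C` of the Type-I certificate ladder, by the recombination of `typeIConcentration_proof` and
`adaptedFrequency_adaptedKernelExists_proof` described in the route file. [this file] -/
theorem cloudStretchingBudget_cloudKillsTypeIRungs_proof :
    Theses.CloudStretchingBudget.CloudKillsTypeIRungs := by
  intro hF hB hG hS C hC ν T hν hT u p hsol hLH hdec hrate
  by_contra hnot
  -- a: the concentration point
  obtain ⟨ρ, hρ, γ, hγ, hconc⟩ := typeIConcentration_proof C hC
  obtain ⟨x₀, hx₀⟩ := hconc ν T hν hT u p hsol hLH hdec hrate hnot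
  -- the rung rate is a Type-I rate
  have hTI : IsTypeIBlowup u T := by
    refine ⟨C * Real.sqrt ν, ?_⟩
    filter_upwards [hrate, self_mem_nhdsWithin] with t ht htT
    intro x
    have hTt : 0 < Real.sqrt (T - t) := Real.sqrt_pos.2 (sub_pos.2 htT)
    rw [le_div_iff₀ hTt, mul_comm]
    exact ht x
  -- b: the adapted kernel at `x₀`
  obtain ⟨t₀, ht₀, G, hGcl, hGbd⟩ :=
    adaptedFrequency_adaptedKernelExists_proof ν T hν hT u p hsol hLH hdec hTI x₀
  -- J₁: the floor
  obtain ⟨m, hm, hfloor⟩ :=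
    hF C hC ν T hν hT u p hsol hLH hdec hrate x₀ ρ γ hρ hγ hx₀ t₀ G ht₀ hGcl hGbd
  -- J₂: the budget; J₃: the bet (quantities instantiated by `rfl`)
  obtain ⟨hMcont, hbudget⟩ :=
    hB ν T hν hT u p hsol hLH hdec x₀ t₀ G ht₀ hGcl hGbd _ _ rfl rfl _ _ _ rfl rfl rfl
  obtain ⟨δ, hδ0, hδ1, t₁, ht₁, hbet⟩ :=
    hS C hC ν T hν hT u p hsol hLH hdec hrate x₀ t₀ G ht₀ hGcl hGbd _ _ rfl rfl _ _ _ rfl rfl rfl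
  -- the Grönwall clock on `[t₁, T)`
  have hclock := hG T t₁ δ _ ht₁.2 hδ0 hδ1 (hMcont.mono (Ico_subset_Ico ht₁.1 le_rfl))
    (fun t₂ t₃ h12 h23 h3T => by
      have h1 := hbudget t₂ t₃ (ht₁.1.trans h12) h23 h3T
      have h2 := hbet t₂ t₃ h12 h23 h3T
      linarith) m hm
  obtain ⟨t, hfl, hcl⟩ := (hfloor.and hclock).exists
  exact absurd (hfl.trans_lt hcl) (lt_irrefl m)

/-- **`TypeIRungsToClay` (stmt-NavierStokesRegularity-18465).** All rungs `X_C` of the Type-I ladder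
together with `NoTypeII` give Clay (A): `typeICertificateLadder_noBlowupToClay_proof` reduces Clay (A)
to no blow-up; a non-extending solution is maximal, hence Type-I by `NoTypeII`, and
`typeICertificateLadder_ladderGlue_proof` extends it — contradiction. [this file] -/
theorem cloudStretchingBudget_typeIRungsToClay_proof :
    Theses.CloudStretchingBudget.TypeIRungsToClay := by
  intro hR hII
  refine typeICertificateLadder_noBlowupToClay_proof ?_
  intro ν T hν hT u p hsol hLH hdec
  by_contra hnot
  have hmax : IsMaximalSmoothSolution ν 0 u p T := ⟨hsol, hnot⟩
  have hTI := hII ν T hν hT u p hmax hLH hdec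
  exact hnot (typeICertificateLadder_ladderGlue_proof hR ν T hν hT u p hsol hLH hdec hTI)

/-- **`Assembly` (stmt-NavierStokesRegularity-18525)**: the curried deciding theorem of the route,
`SubunitCloudStretching → AdaptedVorticityFloor → CloudKatoBudget → GronwallClock → NoTypeII →
CloudKillsTypeIRungs → TypeIRungsToClay → NavierStokesRegularity` (pure logic). [this file] -/
theorem cloudStretchingBudget_assembly_proof : Theses.CloudStretchingBudget.Assembly :=
  fun hS hF hB hG hII hK hC => hC (hK hF hB hG hS) hII

end Summit.NavierStokesRegularity.NavierStokesRegularity.Theorems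

end
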